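import Summits.BirchSwinnertonDyer.BirchSwinnertonDyer.Theses.ByReductionTypeAtTwo
import Summits.BirchSwinnertonDyer.BirchSwinnertonDyer.Theorems.ByReductionTypeAtTwoRankOneAtTwoBigImageOddLocalFklAssemblyPrimary
import HarnessLib

/-!
# Line `fkl` («FirstKolyvaginLayerAtTwo», ES-K2) — skeleton v9 for crux `RankOneAtTwoBigImageOddLocal`
# (item stmt-BirchSwinnertonDyer-23715, route ByReductionTypeAtTwo; W-42 (β); line author bsd-f1-sign2-es g3;
# v2–v6 = LEAD RESHAPES by prover seat bsd-line-fkl-p1 g0, v7/v7.1 by g2, v8 by g5 — 2026-08-28)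

v9 = v8 with the CITATION stub re-typed over PRIMARY printed facts (integrating width seat bsd-line-fkl-p2 g5, p606992/p607642:
`GrossZagier1986_thm_I_7_3` is now a THEOREM of the tree from {BCDT parametrisation `nonempty_modularParametrizationData`,
`HoffsteinLuo1997_exists_twist_L_one_ne_zero`, GZ86 V.(2.1) `gross_zagier`}); composition via `…FklAssemblyPrimary`
`rankOneAtTwoBigImageOddLocal_of_residues_primary`.  v8 = LEAD RESHAPE by bsd-line-fkl-p1 g5: the SEVEN registered stubs of v7 are now typed BY NAME.  The six OPEN residues
(2a) HC / (2b) NV / (3a) HC_an / (3b) NV_an / (4) Manin ⊗ ℤ₂ at `4 ∣ N` / (5) `ord₂ Ш_an ≥ 0` are the tree's closed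
`@[conjecture]` Props of `Theorems/ByReductionTypeAtTwoRankOneAtTwoFklDefs.lean` (p606299, this gen; bodies = the v7 stub
signatures VERBATIM, so v7 ⟺ v8 stub for stub by `Iff.rfl`), and the whole composition is ONE landed kernel theorem,
`Theorems/…FklAssembly.lean` `RankOneAtTwoFkl.rankOneAtTwoBigImageOddLocal_of_residues`:
  «GZK → modularity → Abbes–Ullmo → Česnavičius → GZ86 I.(7.3) → HC → NV → HC_an → NV_an → ManinOddAdditiveAtTwo →
   ShaAnTwoIntegralOnBigImageSlice → RankOneAtTwoBigImageOddLocal».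
So the skeleton below is seven one-line stubs and a one-line composition; everything else of v1–v7 (period transfer on the
slice, `w = −1` from `r_an = 1`, `Ш_an ∈ ℚ^×`, K2-F ⟺ HC ∧ NV, the crosswise use of the residues, the two HALF-SLICES
`{Ш[2] = 0}` ↦ (NV, HC_an) only / `{Ш_an odd}` ↦ (HC, NV_an) only) lives in landed Theorems files
(`…FklSupports` p591631, `…FklLossless` p592053, `…FklLevelOne` p592555, `…FklPrimeLevelDictionary` p593426, `…FklLevelOneLaw`
p593869, `…FklLevelParity` p594285, `…FklClauseA` p595057, `…StubShaAnRationalOnSlice` p592406, `…FklResidues` p596672,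
`…FklTopLevel` p597859, `…FklLevelShift` p598376, `…FklTwistLValue` p599166, `…FklPsiIndependence` p599816,
`…FklFirstNonVanishingLevel` p600341, `…RankOneAtTwoFklDefs` p606299 + APPEND p607223 (the four LEVEL-TWO SHADOWS
`LevelTwoTwist{NonVanishing,Congruence}AtTwo`, `AnalyticLevelTwoTwist{NonVanishing,Congruence}AtTwo` — prime quadratic twists mod 4),
`…FklAssembly` p606641, `…FklTwistParity` p607777: off the corner `{Ш[2] ≠ 0 ∧ 2 ∣ Ш_an}` only LEVEL TWO is load-bearing —
`{Ш[2] = 0}` ↦ (L2-NV, L2-HC_an), `{Ш_an odd}` ↦ (L2-HC, L2-NV_an), each shadow implied by its residue).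
STATUS of the stubs (unchanged since v7; see `Lines/fkl.md`, `FklLeadReportG0/G2.md`, `PICKED.md`):
* (1) `stub_fklPub` — PRINT, closed by citation only (five tree named facts, none with a `_holds`); the crux as typed can close
  BY NAME only after a Pub-split of the item (plan note D-0014: `R1SlicePublishedInputsAtTwo → …`, the route's 19096 pattern).
* (2a) HC, (2b) NV, (3a) HC_an, (3b) NV_an — OPEN at `p = 2` (Kolyvagin-system structure / Kolyvagin non-triviality at `2`;
  every printed template has `p` odd); kernel readings landed: level 2 = `T_ℓ(f) mod 4 = L(E^{(ℓ)},1)/Ω(E^{(ℓ)}) mod 4ℤ_(2)`,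
  NV(s = 0) ⟸ one `τ`-prime twist with `L^{alg} = 2·odd`, top level redundant, one `ψ` per row, K2-F = «first non-vanishing
  level is `s+2`».  Instruments DES9–DES11 (0/17 572), D-fkl-g2-1 (8 411/8 411, 13 059/13 059, 13 541/13 541, 6 865/6 865).
* (4) Manin ⊗ ℤ₂ at `4 ∣ N` — OPEN (CNS arXiv:1911.09446: only `v₂(c) ≤ v₂(deg φ)`).  (5) `ord₂ Ш_an ≥ 0` — OPEN, NECESSARY.
Sorries ONLY inside `stub_*`.  BSD is not proved by any of this.
-/

noncomputable section

open scoped Classical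

set_option linter.dupNamespace false

open Literature.NumberTheory.EllipticCurves Literature.NumberTheory.EllipticCurves.ModularForms
  Summit.BirchSwinnertonDyer.Rank1Residual.F1Sign2
  Summit.BirchSwinnertonDyer.BirchSwinnertonDyer.Theses.ByReductionTypeAtTwo

namespace Summit.BirchSwinnertonDyer.BirchSwinnertonDyer.Cruxes.RankOneAtTwoBigImageOddLocal

namespace Fkl

/-- stub (1) [v9]: ALL the PUBLISHED inputs of the line, one citation stub (closed by citation only, never progress), now over
PRIMARY printed facts of the tree: (i) Gross–Zagier–Kolyvagin — rank = analytic rank ≤ 1 and Ш finite; (ii) modularity — a newform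
of `W` at level `N_W` exists, and (ii′) BCDT Thm A — a modular parametrisation datum exists; (iii) Abbes–Ullmo 1996 Thm A and
(iv) Česnavičius 2018 Thm 1.2 — the Manin constant of an optimal parametrisation is odd for `2 ∤ N`, resp. `2 ∥ N`;
(v) Hoffstein–Luo 1997 — a non-vanishing quadratic twist with prescribed splitting; (vi) Gross–Zagier 1986 Thm V.(2.1) — the
Gross–Zagier formula over a Heegner field.  ((v) ∧ (vi) ∧ (ii′) ⟹ GZ86 Thm I.(7.3), the v4–v8 conjunct, by the width seat's landed
`GrossZagier1986_thm_I_7_3_of_hoffsteinLuo`, p607642.) [cite: GrossZagier1986, Thm. V.(2.1) and Thm. I.(7.3)]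
[cite: AbbesUllmo1996, Thm. A] [cite: Cesnavicius2018, Thm. 1.2] [cite: HoffsteinLuo1997, Thm.] -/
theorem stub_fklPub :
    rank_eq_analyticRank_of_analyticRank_le_one ∧ exists_isNewformOf ∧
      abbesUllmo_not_dvd_maninConstant_of_not_dvd_level ∧ cesnavicius_not_two_dvd_maninConstant_of_two_dvd_level ∧
      nonempty_modularParametrizationData ∧ HoffsteinLuo1997_exists_twist_L_one_ne_zero ∧
      (∀ (N : ℕ) [NeZero N] (W : WeierstrassCurve ℚ) (K : Type) [Field K] [NumberField K], gross_zagier N W K) := by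
  sorry

/-- stub (2a) [v8 = v7 by name]: **(HC) the higher congruence of the first Kolyvagin layer at `2`** — tree conjecture
`RankOneAtTwoFkl.FirstLayerHigherCongruenceAtTwo` (Kolyvagin direction; OPEN at `p = 2`). -/
theorem stub_firstLayerHigherCongruence :
    Summit.BirchSwinnertonDyer.BirchSwinnertonDyer.Theorems.RankOneAtTwoFkl.FirstLayerHigherCongruenceAtTwo := by
  sorry

/-- stub (2b) [v8 = v7 by name]: **(NV) the non-vanishing of the first Kolyvagin layer at `2`** — tree conjecture
`RankOneAtTwoFkl.FirstLayerNonVanishingAtTwo` (Kolyvagin non-triviality at `2`, exact exponent; OPEN — HARDEST). -/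
theorem stub_firstLayerNonVanishing :
    Summit.BirchSwinnertonDyer.BirchSwinnertonDyer.Theorems.RankOneAtTwoFkl.FirstLayerNonVanishingAtTwo := by
  sorry

/-- stub (3a) [v8 = v7 by name]: **(HC_an) the higher congruence of the analytic first-layer law at `2`** — tree conjecture
`RankOneAtTwoFkl.AnalyticFirstLayerHigherCongruenceAtTwo` (modular symbols vs `ord₂ Ш_an`; OPEN; DES9–11 0/17 572). -/
theorem stub_analyticFirstLayerHigherCongruence :
    Summit.BirchSwinnertonDyer.BirchSwinnertonDyer.Theorems.RankOneAtTwoFkl.AnalyticFirstLayerHigherCongruenceAtTwo := by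
  sorry

/-- stub (3b) [v8 = v7 by name]: **(NV_an) the non-vanishing of the analytic first-layer law at `2`** — tree conjecture
`RankOneAtTwoFkl.AnalyticFirstLayerNonVanishingAtTwo` (OPEN; witnessed on every DES9–11 curve whose window reaches `s+2`). -/
theorem stub_analyticFirstLayerNonVanishing :
    Summit.BirchSwinnertonDyer.BirchSwinnertonDyer.Theorems.RankOneAtTwoFkl.AnalyticFirstLayerNonVanishingAtTwo := by
  sorry

/-- stub (4) [v8 = v5 by name]: **Manin's conjecture ⊗ ℤ₂ at additive level** — tree conjecture
`RankOneAtTwoFkl.ManinOddAdditiveAtTwo` (`4 ∣ N ⇒` the optimal Manin constant is odd; OPEN). [cite: Manin1972, §5] -/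
theorem stub_maninOddAdditiveAtTwo :
    Summit.BirchSwinnertonDyer.BirchSwinnertonDyer.Theorems.RankOneAtTwoFkl.ManinOddAdditiveAtTwo := by
  sorry

/-- stub (5) [v8 = v2's (5b) by name]: **`Ш_an` is a `2`-adic integer on the slice** — tree conjecture
`RankOneAtTwoFkl.ShaAnTwoIntegralOnBigImageSlice` (OPEN in the ∀-form; NECESSARY: implied by the crux). [cite: Miller2011, Thm. 7.1] -/
theorem stub_shaAnTwoIntegralOnSlice :
    Summit.BirchSwinnertonDyer.BirchSwinnertonDyer.Theorems.RankOneAtTwoFkl.ShaAnTwoIntegralOnBigImageSlice := by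
  sorry

/-- HELPER (proved, v7/v8): K2-F `F1Sign2.FirstLayerLawAtTwo` (v1–v6 stub `stub_katoFirstLayerLaw`) from stubs (2a) ∧ (2b) via the
landed glue `…FklResidues.firstLayerLawAtTwo_of_residues`. -/
theorem katoFirstLayerLaw_of_stubs : FirstLayerLawAtTwo :=
  Summit.BirchSwinnertonDyer.BirchSwinnertonDyer.Theorems.RankOneAtTwoFkl.firstLayerLawAtTwo_of_residues
    stub_firstLayerHigherCongruence stub_firstLayerNonVanishing

/-- HELPER (proved, v7/v8): K2-F_an `F1Sign2.AnalyticFirstLayerLawAtTwo` (v1–v6 stub `stub_analyticKatoFirstLayerLaw`) from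
stubs (3a) ∧ (3b) via `…FklResidues.analyticFirstLayerLawAtTwo_of_residues`. -/
theorem analyticKatoFirstLayerLaw_of_stubs : AnalyticFirstLayerLawAtTwo :=
  Summit.BirchSwinnertonDyer.BirchSwinnertonDyer.Theorems.RankOneAtTwoFkl.analyticFirstLayerLawAtTwo_of_residues
    stub_analyticFirstLayerHigherCongruence stub_analyticFirstLayerNonVanishing

/-- composition = THE SKELETON [v8]: the crux BY NAME from exactly the seven registered stubs (1 PRINT + 6 OPEN), through the
landed kernel theorem `RankOneAtTwoFkl.rankOneAtTwoBigImageOddLocal_of_residues_primary` (Theorems `…FklAssemblyPrimary`, over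
`…FklAssembly.rankOneAtTwoBigImageOddLocal_of_residues`); no sorry of its own. -/
theorem RankOneAtTwoBigImageOddLocal_of :
    Summit.BirchSwinnertonDyer.BirchSwinnertonDyer.Theses.ByReductionTypeAtTwo.RankOneAtTwoBigImageOddLocal := by
  obtain ⟨hGZK, hmod, hAU, hC, hmodP, hHL, hGZ⟩ := stub_fklPub
  exact Summit.BirchSwinnertonDyer.BirchSwinnertonDyer.Theorems.RankOneAtTwoFkl.rankOneAtTwoBigImageOddLocal_of_residues_primary
    hGZK hmod hAU hC hmodP hHL hGZ stub_firstLayerHigherCongruence stub_firstLayerNonVanishing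
    stub_analyticFirstLayerHigherCongruence stub_analyticFirstLayerNonVanishing stub_maninOddAdditiveAtTwo
    stub_shaAnTwoIntegralOnSlice

/-- HELPER (proved, v8): on the half-slice `{Ш(E)[2] = 0}` only stubs (1), (2b) NV, (3a) HC_an, (4), (5) are used
— in LEVEL-TWO form (prime quadratic twists mod 4): Theorems `…FklTwistParity` / `…FklAssemblyPrimary`; the complement `{Ш(E)[2] ≠ 0}` is the residual stub of the
cell's other line `Lines/egg_kolyvagin_two.lean` v6. -/
theorem bsdp_two_on_shaTwoTrivial_of_stubs :
    ∀ (W : WeierstrassCurve ℚ) [W.IsElliptic] [W.IsGloballyMinimal], ¬ W.HasCM →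
      (∀ n : ℕ, W.HasSurjectiveModNGaloisRep ((2 ^ n : ℕ) : ℤ)) → Odd W.torsionOrder → Odd W.tamagawaProduct →
      W.analyticRank = 1 → Nat.card (AddCommGroup.primaryComponent W.sha 2) = 1 → BSDp W 2 := by
  obtain ⟨hGZK, hmod, hAU, hC, hmodP, hHL, hGZ⟩ := stub_fklPub
  exact Summit.BirchSwinnertonDyer.BirchSwinnertonDyer.Theorems.RankOneAtTwoFkl.bsdp_two_on_shaTwoTrivial_of_levelTwo_primary
    hGZK hmod hAU hC hmodP hHL hGZ
    (Summit.BirchSwinnertonDyer.BirchSwinnertonDyer.Theorems.RankOneAtTwoFkl.levelTwoTwistNonVanishing_of_nonVanishing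
      stub_firstLayerNonVanishing)
    (Summit.BirchSwinnertonDyer.BirchSwinnertonDyer.Theorems.RankOneAtTwoFkl.analyticLevelTwoTwistCongruence_of_analyticHigherCongruence
      stub_analyticFirstLayerHigherCongruence)
    stub_maninOddAdditiveAtTwo stub_shaAnTwoIntegralOnSlice

/-- HELPER (proved, v8): on the half-slice `{Ш_an(E) odd}` only stubs (1), (2a) HC, (3b) NV_an, (4) are used
— in LEVEL-TWO form (Theorems `…FklTwistParity` / `…FklAssemblyPrimary`). -/
theorem bsdp_two_on_shaAnUnit_of_stubs :
    ∀ (W : WeierstrassCurve ℚ) [W.IsElliptic] [W.IsGloballyMinimal], ¬ W.HasCM →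
      (∀ n : ℕ, W.HasSurjectiveModNGaloisRep ((2 ^ n : ℕ) : ℤ)) → Odd W.torsionOrder → Odd W.tamagawaProduct →
      W.analyticRank = 1 → (∀ q : ℚ, shaAn W = (q : ℂ) → padicValRat 2 q = 0) → BSDp W 2 := by
  obtain ⟨hGZK, hmod, hAU, hC, hmodP, hHL, hGZ⟩ := stub_fklPub
  exact Summit.BirchSwinnertonDyer.BirchSwinnertonDyer.Theorems.RankOneAtTwoFkl.bsdp_two_on_shaAnUnit_of_levelTwo_primary
    hGZK hmod hAU hC hmodP hHL hGZ
    (Summit.BirchSwinnertonDyer.BirchSwinnertonDyer.Theorems.RankOneAtTwoFkl.levelTwoTwistCongruence_of_higherCongruence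
      stub_firstLayerHigherCongruence)
    (Summit.BirchSwinnertonDyer.BirchSwinnertonDyer.Theorems.RankOneAtTwoFkl.analyticLevelTwoTwistNonVanishing_of_analyticNonVanishing
      stub_analyticFirstLayerNonVanishing)
    stub_maninOddAdditiveAtTwo

end Fkl

end Summit.BirchSwinnertonDyer.BirchSwinnertonDyer.Cruxes.RankOneAtTwoBigImageOddLocal

end
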